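import Literature.Geometry.Lorentzian.KerrIngoingCoordPullback
import Literature.Geometry.Lorentzian.DecaySymbolsSqrt
import HarnessLib

/-!
# `KerrShieldedDataExist`, line `plug-the-second-sheet` (skeleton v4 "KerrCap") — stub `stub_capFarK`, III:
# symbol estimates for the lapse, the shift and `𝓛_b h` on the far zone of the cap

Support file (`--supports stmt-FinalStateConjecture-10055`; everything proved, no definitions, no named facts)
for the registered stub `stub_capFarK`. Pure symbol calculus (`DecaySymbols*.lean`) for the explicit far-zone
quantities of the cap as functions of `y ∈ E3`, `s = ‖y‖`, `r = ϱ(s) = s + M + (M² − a²)/4s` beyond `σ₅`,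
`Σ_s = r²s² + a²y₂²`, `Δ = r² − 2Mr + a²`, `A_s = (r² + a²)²s² − Δa²(s² − y₂²)`: `r ∈ O_k(1)`, `r/s → 1`
(`isBigOSmooth_far_rho(_div)`); `F ∈ O_k(n)` with `Fs⁻ⁿ → 1` has `F⁻¹ ∈ O_k(−n)` (`isBigOSmooth_far_inv`), whence
`Σ_s⁻¹ ∈ O_k(−4)`, `Δ⁻¹ ∈ O_k(−2)`, `A_s⁻¹ ∈ O_k(−6)`; the shift `b = β ẑ × y`, `β = −2Mras²/A_s`, is `O_k(−2)`
(`isBigOSmooth_far_shift`), the inverse lapse `m = (A_s/(Σ_sΔ))^{1/2}` and the closed-form induced metric are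
`O_k(0)` (`isBigOSmooth_far_invLapse`, `isBigOSmooth_far_hform`), and finally
**`−(m/2)(∂_b[h(v,w)] + h(Db v, w) + h(v, Db w)) ∈ O_k(−3)`** (`isBigOSmooth_capFarK`): the Dafermos–Rodnianski
decay `k = O₁(s⁻³)` of the second fundamental form of the Boyer–Lindquist slice in quasi-isotropic coordinates.

References: Bartnik, CPAM 39 (1986), Def. 2.1; Brandt–Seidel, PRD 54 (1996) 1403, §II; Dafermos–Rodnianski 2008.
-/

-- the doubled `FinalStateConjecture` path component is the summit/problem naming scheme, not a mistake
set_option linter.dupNamespace false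

noncomputable section

open Set Function Filter Topology TopologicalSpace Bornology
open scoped Manifold ContDiff Topology InnerProductSpace
open Literature.Geometry.Lorentzian

namespace Summit.FinalStateConjecture.FinalStateConjecture.Theorems.SwallowTheDatum

namespace KerrCap

/-! ### Reciprocals of symbols with a power-law leading term -/

/-- **A scalar symbol `F ∈ O_k(sⁿ)` with `F s⁻ⁿ → 1` has `F⁻¹ ∈ O_k(s⁻ⁿ)`** (`IsBigOSmooth.inv` applied to
`F s⁻ⁿ ∈ O_k(0)`, and `F⁻¹ = s⁻ⁿ (F s⁻ⁿ)⁻¹`). [folklore] -/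
theorem isBigOSmooth_far_inv {F : E3 → ℝ} {k n : ℕ} (hF : IsBigOSmooth k n F)
    (h1 : Tendsto (fun y : E3 ↦ F y * ‖y‖⁻¹ ^ n) (cobounded E3) (𝓝 1)) :
    IsBigOSmooth k (-(n : ℝ)) fun y : E3 ↦ (F y)⁻¹ := by
  have hG : IsBigOSmooth k 0 fun y : E3 ↦ F y * ‖y‖⁻¹ ^ n := by
    have h := hF.mul (isBigOSmooth_inv_norm_pow (E' := E3) k n)
    rwa [add_neg_cancel] at h
  have h := (isBigOSmooth_inv_norm_pow (E' := E3) k n).mul (hG.inv h1)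
  rw [add_zero] at h
  refine h.congr_far (R₁ := 0) fun y hy ↦ ?_
  have hs : ‖y‖⁻¹ ^ n ≠ 0 := pow_ne_zero _ (inv_ne_zero hy.ne')
  rw [mul_inv, ← mul_assoc, mul_comm (‖y‖⁻¹ ^ n), mul_assoc, mul_inv_cancel₀ hs, mul_one]

/-! ### The quasi-isotropic radius as a symbol -/

section Symbols

variable {ϱ : ℝ → ℝ} {M a σ₅ : ℝ} (hσ₅ : 0 < σ₅)
  (hfar : ∀ s, σ₅ ≤ s → ϱ s = s + M + (M ^ 2 - a ^ 2) / (4 * s))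

include hσ₅ hfar

/-- `r = ϱ(s) = s + M + c₀/s ∈ O_k(1)`, `c₀ = (M² − a²)/4`. [cite: Bartnik1986, Def. 2.1] -/
theorem isBigOSmooth_far_rho (k : ℕ) : IsBigOSmooth k 1 fun y : E3 ↦ ϱ ‖y‖ := by
  have h := (((isBigOSmooth_norm (E' := E3) k).add ((isBigOSmooth_const k M).mono (by norm_num))).add
    (((isBigOSmooth_inv_norm_all (E' := E3) k).const_mul ((M ^ 2 - a ^ 2) / 4)).mono (by norm_num)))
  refine h.congr_far (R₁ := σ₅) fun y hy ↦ ?_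
  have hs : ‖y‖ ≠ 0 := (hσ₅.trans hy).ne'
  rw [hfar ‖y‖ hy.le]
  field_simp

/-- `r/s − 1 = M/s + c₀/s² ∈ O_k(−1)`; hence `r/s ∈ O_k(0)` and `r/s → 1`. [cite: Bartnik1986, Def. 2.1] -/
theorem isBigOSmooth_far_rho_div (k : ℕ) :
    IsBigOSmooth k (-1) (fun y : E3 ↦ ϱ ‖y‖ * ‖y‖⁻¹ - 1) ∧ IsBigOSmooth k 0 (fun y : E3 ↦ ϱ ‖y‖ * ‖y‖⁻¹) ∧
      Tendsto (fun y : E3 ↦ ϱ ‖y‖ * ‖y‖⁻¹) (cobounded E3) (𝓝 1) := by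
  have hg : IsBigOSmooth k (-1) fun y : E3 ↦ M * ‖y‖⁻¹ + (M ^ 2 - a ^ 2) / 4 * ‖y‖⁻¹ ^ 2 :=
    ((isBigOSmooth_inv_norm_all (E' := E3) k).const_mul M).add
      (((isBigOSmooth_inv_norm_pow (E' := E3) k 2).const_mul _).mono (by norm_num))
  have heq : ∀ y : E3, σ₅ < ‖y‖ → M * ‖y‖⁻¹ + (M ^ 2 - a ^ 2) / 4 * ‖y‖⁻¹ ^ 2 = ϱ ‖y‖ * ‖y‖⁻¹ - 1 := by
    intro y hy
    have hs : ‖y‖ ≠ 0 := (hσ₅.trans hy).ne'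
    rw [hfar ‖y‖ hy.le]
    field_simp
    ring
  have h1 : IsBigOSmooth k (-1) (fun y : E3 ↦ ϱ ‖y‖ * ‖y‖⁻¹ - 1) := hg.congr_far heq
  refine ⟨h1, ((isBigOSmooth_const k (1 : ℝ)).add (h1.mono (by norm_num))).congr fun y ↦ by ring, ?_⟩
  exact (h1.tendsto_const_add (by norm_num) (1 : ℝ)).congr fun y ↦ by ring

/-- **`Σ_s = r²s² + a²y₂² ∈ O_k(4)`, `Σ_s⁻¹ ∈ O_k(−4)`** (`Σ_s s⁻⁴ − 1 ∈ O_k(−1)`). [cite: Bartnik1986, Def. 2.1] -/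
theorem isBigOSmooth_far_sigmaInv (k : ℕ) :
    IsBigOSmooth k 4 (fun y : E3 ↦ ϱ ‖y‖ ^ 2 * ‖y‖ ^ 2 + a ^ 2 * y 2 ^ 2) ∧
      IsBigOSmooth k (-4) (fun y : E3 ↦ (ϱ ‖y‖ ^ 2 * ‖y‖ ^ 2 + a ^ 2 * y 2 ^ 2)⁻¹) ∧
      IsBigOSmooth k (-1) (fun y : E3 ↦ (ϱ ‖y‖ ^ 2 * ‖y‖ ^ 2 + a ^ 2 * y 2 ^ 2) * ‖y‖⁻¹ ^ 4 - 1) := by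
  have hρ := isBigOSmooth_far_rho hσ₅ hfar k
  obtain ⟨hq1, hq, -⟩ := isBigOSmooth_far_rho_div hσ₅ hfar k
  have hy2 : IsBigOSmooth k 1 fun y : E3 ↦ y 2 :=
    (isBigOSmooth_clm_apply (EuclideanSpace.proj 2 : E3 →L[ℝ] ℝ) k).congr fun y ↦ by simp
  have hS : IsBigOSmooth k 4 (fun y : E3 ↦ ϱ ‖y‖ ^ 2 * ‖y‖ ^ 2 + a ^ 2 * y 2 ^ 2) := by
    have h1 := (hρ.mul hρ).mul (isBigOSmooth_norm_sq (E' := E3) k)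
    rw [show (1 : ℝ) + 1 + 2 = 4 by norm_num] at h1
    exact (h1.add (((hy2.mul hy2).const_mul (a ^ 2)).mono (b := 4) (by norm_num))).congr fun y ↦ by ring
  -- `Σ_s s⁻⁴ − 1 = (r/s − 1)(r/s + 1) + a² y₂² s⁻⁴ ∈ O(−1)`
  have hg : IsBigOSmooth k (-1) fun y : E3 ↦
      (ϱ ‖y‖ * ‖y‖⁻¹ - 1) * (ϱ ‖y‖ * ‖y‖⁻¹ + 1) + a ^ 2 * (y 2 * y 2 * ‖y‖⁻¹ ^ 4) := by
    have h1 := hq1.mul (hq.add (isBigOSmooth_const k (1 : ℝ)))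
    have h2 := (((hy2.mul hy2).mul (isBigOSmooth_inv_norm_pow (E' := E3) k 4)).const_mul (a ^ 2))
    rw [show (-1 : ℝ) + 0 = -1 by norm_num] at h1; rw [show ((1 : ℝ) + 1 + -(4 : ℕ)) = -2 by norm_num] at h2
    exact h1.add (h2.mono (by norm_num))
  have hg' : IsBigOSmooth k (-1) (fun y : E3 ↦ (ϱ ‖y‖ ^ 2 * ‖y‖ ^ 2 + a ^ 2 * y 2 ^ 2) * ‖y‖⁻¹ ^ 4 - 1) := by
    refine hg.congr_far (R₁ := 0) fun y hy ↦ ?_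
    have hs : ‖y‖ ≠ 0 := hy.ne'
    field_simp
    ring
  refine ⟨hS, ?_, hg'⟩
  have h := isBigOSmooth_far_inv (n := 4) (by exact_mod_cast hS)
    ((hg'.tendsto_const_add (by norm_num) (1 : ℝ)).congr fun y ↦ by ring)
  exact_mod_cast h

/-- **`Δ = r² − 2Mr + a² ∈ O_k(2)`, `Δ⁻¹ ∈ O_k(−2)`** (`Δ s⁻² − 1 ∈ O_k(−1)`). [cite: Bartnik1986, Def. 2.1] -/
theorem isBigOSmooth_far_deltaInv (k : ℕ) :
    IsBigOSmooth k 2 (fun y : E3 ↦ ϱ ‖y‖ ^ 2 - 2 * M * ϱ ‖y‖ + a ^ 2) ∧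
      IsBigOSmooth k (-2) (fun y : E3 ↦ (ϱ ‖y‖ ^ 2 - 2 * M * ϱ ‖y‖ + a ^ 2)⁻¹) ∧
      IsBigOSmooth k (-1) (fun y : E3 ↦ (ϱ ‖y‖ ^ 2 - 2 * M * ϱ ‖y‖ + a ^ 2) * ‖y‖⁻¹ ^ 2 - 1) := by
  have hρ := isBigOSmooth_far_rho hσ₅ hfar k
  obtain ⟨hq1, hq, -⟩ := isBigOSmooth_far_rho_div hσ₅ hfar k
  have hD : IsBigOSmooth k 2 (fun y : E3 ↦ ϱ ‖y‖ ^ 2 - 2 * M * ϱ ‖y‖ + a ^ 2) := by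
    have h1 := hρ.mul hρ
    rw [show (1 : ℝ) + 1 = 2 by norm_num] at h1
    exact ((h1.sub ((hρ.const_mul (2 * M)).mono (by norm_num))).add
      ((isBigOSmooth_const k (a ^ 2)).mono (by norm_num))).congr fun y ↦ by ring
  -- `Δ s⁻² − 1 = (r/s − 1)(r/s + 1) − 2M (r/s) s⁻¹ + a² s⁻² ∈ O(−1)`
  have hg : IsBigOSmooth k (-1) fun y : E3 ↦
      (ϱ ‖y‖ * ‖y‖⁻¹ - 1) * (ϱ ‖y‖ * ‖y‖⁻¹ + 1) - 2 * M * (ϱ ‖y‖ * ‖y‖⁻¹ * ‖y‖⁻¹) +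
        a ^ 2 * ‖y‖⁻¹ ^ 2 := by
    have h1 := hq1.mul (hq.add (isBigOSmooth_const k (1 : ℝ)))
    have h2 := (hq.mul (isBigOSmooth_inv_norm_all (E' := E3) k)).const_mul (2 * M)
    have h3 := ((isBigOSmooth_inv_norm_pow (E' := E3) k 2).const_mul (a ^ 2))
    rw [show (-1 : ℝ) + 0 = -1 by norm_num] at h1; rw [show (0 : ℝ) + -1 = -1 by norm_num] at h2
    exact (h1.sub h2).add (h3.mono (by norm_num))
  have hg' : IsBigOSmooth k (-1) (fun y : E3 ↦ (ϱ ‖y‖ ^ 2 - 2 * M * ϱ ‖y‖ + a ^ 2) * ‖y‖⁻¹ ^ 2 - 1) :=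
    hg.congr fun y ↦ by ring
  refine ⟨hD, ?_, hg'⟩
  have h := isBigOSmooth_far_inv (n := 2) (by exact_mod_cast hD)
    ((hg'.tendsto_const_add (by norm_num) (1 : ℝ)).congr fun y ↦ by ring)
  exact_mod_cast h

/-- **`A_s = (r² + a²)²s² − Δa²(s² − y₂²) ∈ O_k(6)`, `A_s⁻¹ ∈ O_k(−6)`** (`A_s s⁻⁶ − 1 ∈ O_k(−1)`).
[cite: Bartnik1986, Def. 2.1] -/
theorem isBigOSmooth_far_AInv (k : ℕ) :
    IsBigOSmooth k 6 (fun y : E3 ↦ (ϱ ‖y‖ ^ 2 + a ^ 2) ^ 2 * ‖y‖ ^ 2 -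
        (ϱ ‖y‖ ^ 2 - 2 * M * ϱ ‖y‖ + a ^ 2) * a ^ 2 * (‖y‖ ^ 2 - y 2 ^ 2)) ∧
      IsBigOSmooth k (-6) (fun y : E3 ↦ ((ϱ ‖y‖ ^ 2 + a ^ 2) ^ 2 * ‖y‖ ^ 2 -
        (ϱ ‖y‖ ^ 2 - 2 * M * ϱ ‖y‖ + a ^ 2) * a ^ 2 * (‖y‖ ^ 2 - y 2 ^ 2))⁻¹) ∧
      IsBigOSmooth k (-1) (fun y : E3 ↦ ((ϱ ‖y‖ ^ 2 + a ^ 2) ^ 2 * ‖y‖ ^ 2 -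
        (ϱ ‖y‖ ^ 2 - 2 * M * ϱ ‖y‖ + a ^ 2) * a ^ 2 * (‖y‖ ^ 2 - y 2 ^ 2)) * ‖y‖⁻¹ ^ 6 - 1) := by
  have hρ := isBigOSmooth_far_rho hσ₅ hfar k
  obtain ⟨hq1, hq, -⟩ := isBigOSmooth_far_rho_div hσ₅ hfar k
  obtain ⟨hD, -, hDg⟩ := isBigOSmooth_far_deltaInv hσ₅ hfar (M := M) (a := a) k
  have hy2 : IsBigOSmooth k 1 fun y : E3 ↦ y 2 :=
    (isBigOSmooth_clm_apply (EuclideanSpace.proj 2 : E3 →L[ℝ] ℝ) k).congr fun y ↦ by simp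
  have hn2 := isBigOSmooth_norm_sq (E' := E3) k
  have hP : IsBigOSmooth k 2 fun y : E3 ↦ ϱ ‖y‖ ^ 2 + a ^ 2 := by
    have h1 := hρ.mul hρ
    rw [show (1 : ℝ) + 1 = 2 by norm_num] at h1
    exact (h1.add ((isBigOSmooth_const k (a ^ 2)).mono (by norm_num))).congr fun y ↦ by ring
  have hA : IsBigOSmooth k 6 (fun y : E3 ↦ (ϱ ‖y‖ ^ 2 + a ^ 2) ^ 2 * ‖y‖ ^ 2 -
      (ϱ ‖y‖ ^ 2 - 2 * M * ϱ ‖y‖ + a ^ 2) * a ^ 2 * (‖y‖ ^ 2 - y 2 ^ 2)) := by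
    have hy22 : IsBigOSmooth k 2 fun y : E3 ↦ y 2 ^ 2 := by
      have h := hy2.mul hy2
      rw [show (1 : ℝ) + 1 = 2 by norm_num] at h
      exact h.congr fun y ↦ by ring
    have h1 := (hP.mul hP).mul hn2
    have h2 := (hD.const_mul (a ^ 2)).mul (hn2.sub hy22)
    rw [show (2 : ℝ) + 2 + 2 = 6 by norm_num] at h1; rw [show (2 : ℝ) + 2 = 4 by norm_num] at h2
    exact (h1.sub (h2.mono (by norm_num))).congr fun y ↦ by ring
  -- `A_s s⁻⁶ = 1 + g`, `g ∈ O(−1)`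
  have hPq : IsBigOSmooth k (-1) fun y : E3 ↦ (ϱ ‖y‖ * ‖y‖⁻¹) ^ 2 + a ^ 2 * ‖y‖⁻¹ ^ 2 - 1 := by
    have h1 := hq1.mul (hq.add (isBigOSmooth_const k (1 : ℝ)))
    have h3 := ((isBigOSmooth_inv_norm_pow (E' := E3) k 2).const_mul (a ^ 2))
    rw [show (-1 : ℝ) + 0 = -1 by norm_num] at h1
    exact (h1.add (h3.mono (by norm_num))).congr fun y ↦ by ring
  have hPq0 : IsBigOSmooth k 0 fun y : E3 ↦ (ϱ ‖y‖ * ‖y‖⁻¹) ^ 2 + a ^ 2 * ‖y‖⁻¹ ^ 2 :=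
    ((isBigOSmooth_const k (1 : ℝ)).add (hPq.mono (by norm_num))).congr fun y ↦ by ring
  have he : IsBigOSmooth k (-2) fun y : E3 ↦ ‖y‖⁻¹ ^ 2 - y 2 * y 2 * ‖y‖⁻¹ ^ 4 := by
    have h2 := (hy2.mul hy2).mul (isBigOSmooth_inv_norm_pow (E' := E3) k 4)
    rw [show ((1 : ℝ) + 1 + -(4 : ℕ)) = -2 by norm_num] at h2
    exact (by exact_mod_cast isBigOSmooth_inv_norm_pow (E' := E3) k 2 : IsBigOSmooth k (-2)
      fun y : E3 ↦ ‖y‖⁻¹ ^ 2).sub h2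
  have hDq0 : IsBigOSmooth k 0 fun y : E3 ↦ (ϱ ‖y‖ ^ 2 - 2 * M * ϱ ‖y‖ + a ^ 2) * ‖y‖⁻¹ ^ 2 :=
    ((isBigOSmooth_const k (1 : ℝ)).add (hDg.mono (by norm_num))).congr fun y ↦ by ring
  have hg : IsBigOSmooth k (-1) fun y : E3 ↦
      ((ϱ ‖y‖ * ‖y‖⁻¹) ^ 2 + a ^ 2 * ‖y‖⁻¹ ^ 2 - 1) * ((ϱ ‖y‖ * ‖y‖⁻¹) ^ 2 + a ^ 2 * ‖y‖⁻¹ ^ 2 + 1) -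
        (ϱ ‖y‖ ^ 2 - 2 * M * ϱ ‖y‖ + a ^ 2) * ‖y‖⁻¹ ^ 2 * (a ^ 2 * (‖y‖⁻¹ ^ 2 - y 2 * y 2 * ‖y‖⁻¹ ^ 4)) := by
    have h1 := hPq.mul (hPq0.add (isBigOSmooth_const k (1 : ℝ)))
    have h2 := hDq0.mul (he.const_mul (a ^ 2))
    rw [show (-1 : ℝ) + 0 = -1 by norm_num] at h1; rw [show (0 : ℝ) + -2 = -2 by norm_num] at h2
    exact h1.sub (h2.mono (by norm_num))
  have hg' : IsBigOSmooth k (-1) (fun y : E3 ↦ ((ϱ ‖y‖ ^ 2 + a ^ 2) ^ 2 * ‖y‖ ^ 2 -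
      (ϱ ‖y‖ ^ 2 - 2 * M * ϱ ‖y‖ + a ^ 2) * a ^ 2 * (‖y‖ ^ 2 - y 2 ^ 2)) * ‖y‖⁻¹ ^ 6 - 1) := by
    refine hg.congr_far (R₁ := 0) fun y hy ↦ ?_
    have hs : ‖y‖ ≠ 0 := hy.ne'
    field_simp
    ring
  refine ⟨hA, ?_, hg'⟩
  have h := isBigOSmooth_far_inv (n := 6) (by exact_mod_cast hA)
    ((hg'.tendsto_const_add (by norm_num) (1 : ℝ)).congr fun y ↦ by ring)
  exact_mod_cast h


/-! ### The shift, the inverse lapse and the induced metric as symbols -/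

/-- **The shift field `b = β ẑ × y`, `β = −2Mras²/A_s`, is an `O_k(s⁻²)` symbol** (`β ∈ O_k(−3)`: `r ∈ O(1)`,
`s² ∈ O(2)`, `A_s⁻¹ ∈ O(−6)`; `ẑ × y` is linear; Brandt–Seidel 1996, §II: `β^φ = O(r⁻³)`). [cite: BrandtSeidel1996, §II] -/
theorem isBigOSmooth_far_shift (k : ℕ) {b : E3 → E3}
    (hb : ∀ u : E3, b u = (-(2 * M * ϱ ‖u‖ * a * ‖u‖ ^ 2 /
        ((ϱ ‖u‖ ^ 2 + a ^ 2) ^ 2 * ‖u‖ ^ 2 -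
          (ϱ ‖u‖ ^ 2 - 2 * M * ϱ ‖u‖ + a ^ 2) * a ^ 2 * (‖u‖ ^ 2 - u 2 ^ 2)))) • !₂[-u 1, u 0, 0]) :
    IsBigOSmooth k (-2) b := by
  have hρ := isBigOSmooth_far_rho hσ₅ hfar k
  obtain ⟨-, hAi, -⟩ := isBigOSmooth_far_AInv hσ₅ hfar (M := M) (a := a) k
  have hβ := ((hρ.mul (isBigOSmooth_norm_sq (E' := E3) k)).mul hAi).const_mul (-(2 * M * a))
  rw [show (1 : ℝ) + 2 + -6 = -3 by norm_num] at hβ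
  set J : E3 →L[ℝ] E3 := (-(EuclideanSpace.proj (1 : Fin 3) : E3 →L[ℝ] ℝ)).smulRight
      (EuclideanSpace.single (0 : Fin 3) (1 : ℝ)) +
    (EuclideanSpace.proj (0 : Fin 3) : E3 →L[ℝ] ℝ).smulRight (EuclideanSpace.single (1 : Fin 3) (1 : ℝ)) with hJ
  have hJy : ∀ y : E3, J y = !₂[-y 1, y 0, 0] := fun y ↦ by
    ext i
    fin_cases i <;> simp [hJ]
  have h := hβ.smul (isBigOSmooth_clm_apply J k)
  rw [show (-3 : ℝ) + 1 = -2 by norm_num] at h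
  refine h.congr fun y ↦ ?_
  rw [hb y, hJy y]
  congr 1
  ring

/-- **The inverse lapse `m = (A_s/(Σ_sΔ))^{1/2}` is an `O_k(1)` symbol**: `A_sΣ_s⁻¹Δ⁻¹ ∈ O_k(0)` tends to `1`
(`A_ss⁻⁶, Σ_ss⁻⁴, Δs⁻² → 1`), and square roots of such symbols are symbols (`IsBigOSmooth.sqrt`).
Bardeen–Press–Teukolsky 1972, (2.3) (`e^{−2ν} = A/(ΣΔ) → 1`). [cite: Bartnik1986, Def. 2.1] -/
theorem isBigOSmooth_far_invLapse (k : ℕ) {m : E3 → ℝ}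
    (hm : ∀ u : E3, m u = Real.sqrt (((ϱ ‖u‖ ^ 2 + a ^ 2) ^ 2 * ‖u‖ ^ 2 -
          (ϱ ‖u‖ ^ 2 - 2 * M * ϱ ‖u‖ + a ^ 2) * a ^ 2 * (‖u‖ ^ 2 - u 2 ^ 2)) /
        ((ϱ ‖u‖ ^ 2 * ‖u‖ ^ 2 + a ^ 2 * u 2 ^ 2) * (ϱ ‖u‖ ^ 2 - 2 * M * ϱ ‖u‖ + a ^ 2)))) :
    IsBigOSmooth k 0 m := by
  obtain ⟨-, hSi, hSg⟩ := isBigOSmooth_far_sigmaInv hσ₅ hfar (M := M) (a := a) k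
  obtain ⟨-, hDi, hDg⟩ := isBigOSmooth_far_deltaInv hσ₅ hfar (M := M) (a := a) k
  obtain ⟨hA, -, hAg⟩ := isBigOSmooth_far_AInv hσ₅ hfar (M := M) (a := a) k
  have hQ := (hA.mul hSi).mul hDi
  rw [show (6 : ℝ) + -4 + -2 = 0 by norm_num] at hQ
  -- the limit `A_s Σ_s⁻¹ Δ⁻¹ → 1`
  have tA := (hAg.tendsto_const_add (by norm_num) (1 : ℝ)).congr (f₂ := fun y : E3 ↦
    ((ϱ ‖y‖ ^ 2 + a ^ 2) ^ 2 * ‖y‖ ^ 2 - (ϱ ‖y‖ ^ 2 - 2 * M * ϱ ‖y‖ + a ^ 2) * a ^ 2 * (‖y‖ ^ 2 - y 2 ^ 2)) *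
      ‖y‖⁻¹ ^ 6) fun y ↦ by ring
  have tS := ((hSg.tendsto_const_add (by norm_num) (1 : ℝ)).congr (f₂ := fun y : E3 ↦
    (ϱ ‖y‖ ^ 2 * ‖y‖ ^ 2 + a ^ 2 * y 2 ^ 2) * ‖y‖⁻¹ ^ 4) fun y ↦ by ring).inv₀ one_ne_zero
  have tD := ((hDg.tendsto_const_add (by norm_num) (1 : ℝ)).congr (f₂ := fun y : E3 ↦
    (ϱ ‖y‖ ^ 2 - 2 * M * ϱ ‖y‖ + a ^ 2) * ‖y‖⁻¹ ^ 2) fun y ↦ by ring).inv₀ one_ne_zero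
  have hQ1 : Tendsto (fun y : E3 ↦ ((ϱ ‖y‖ ^ 2 + a ^ 2) ^ 2 * ‖y‖ ^ 2 -
        (ϱ ‖y‖ ^ 2 - 2 * M * ϱ ‖y‖ + a ^ 2) * a ^ 2 * (‖y‖ ^ 2 - y 2 ^ 2)) *
      (ϱ ‖y‖ ^ 2 * ‖y‖ ^ 2 + a ^ 2 * y 2 ^ 2)⁻¹ * (ϱ ‖y‖ ^ 2 - 2 * M * ϱ ‖y‖ + a ^ 2)⁻¹)
      (cobounded E3) (𝓝 1) := by
    have h := (tA.mul tS).mul tD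
    rw [inv_one, mul_one, mul_one] at h
    refine h.congr' ?_
    filter_upwards [eventually_cobounded_lt_norm (E := E3) 0] with y hy
    have hs : ‖y‖ ≠ 0 := hy.ne'
    simp only [inv_pow, mul_inv, inv_inv]
    field_simp
  refine (hQ.sqrt hQ1).congr fun y ↦ ?_
  rw [hm y, div_eq_mul_inv, mul_inv, mul_assoc]

/-- **The closed-form induced metric of the far zone is an `O_k(1)` symbol**: for fixed `v, w`,
`y ↦ (Σ_s/s⁴)⟪v, w⟫ + a²(r²s² + 2Mrs² + a²y₂²)/(Σ_s s⁴)(y₀v₁ − y₁v₀)(y₀w₁ − y₁w₀) ∈ O_k(0)`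
(`Σ_s/s⁴ ∈ O(0)`, second coefficient `O(−4)`, the `ω`'s `O(1)`). [cite: Bartnik1986, Def. 2.1] -/
theorem isBigOSmooth_far_hform (k : ℕ) (v w : E3) :
    IsBigOSmooth k 0 (fun y : E3 ↦ (ϱ ‖y‖ ^ 2 * ‖y‖ ^ 2 + a ^ 2 * y 2 ^ 2) / ‖y‖ ^ 4) ∧
      IsBigOSmooth k (-4) (fun y : E3 ↦ a ^ 2 * (ϱ ‖y‖ ^ 2 * ‖y‖ ^ 2 + 2 * M * ϱ ‖y‖ * ‖y‖ ^ 2 +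
          a ^ 2 * y 2 ^ 2) / ((ϱ ‖y‖ ^ 2 * ‖y‖ ^ 2 + a ^ 2 * y 2 ^ 2) * ‖y‖ ^ 4)) ∧
      IsBigOSmooth k 0 (fun y : E3 ↦ (ϱ ‖y‖ ^ 2 * ‖y‖ ^ 2 + a ^ 2 * y 2 ^ 2) / ‖y‖ ^ 4 * ⟪v, w⟫_ℝ +
        a ^ 2 * (ϱ ‖y‖ ^ 2 * ‖y‖ ^ 2 + 2 * M * ϱ ‖y‖ * ‖y‖ ^ 2 + a ^ 2 * y 2 ^ 2) /
            ((ϱ ‖y‖ ^ 2 * ‖y‖ ^ 2 + a ^ 2 * y 2 ^ 2) * ‖y‖ ^ 4) *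
          ((y 0 * v 1 - y 1 * v 0) * (y 0 * w 1 - y 1 * w 0))) := by
  have hρ := isBigOSmooth_far_rho hσ₅ hfar k
  obtain ⟨hS, hSi, -⟩ := isBigOSmooth_far_sigmaInv hσ₅ hfar (M := M) (a := a) k
  have hy : ∀ i : Fin 3, IsBigOSmooth k 1 fun y : E3 ↦ y i := fun i ↦
    (isBigOSmooth_clm_apply (EuclideanSpace.proj i : E3 →L[ℝ] ℝ) k).congr fun y ↦ by simp
  have hn4 := isBigOSmooth_inv_norm_pow (E' := E3) k 4
  have hn2 := isBigOSmooth_norm_sq (E' := E3) k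
  have h1 : IsBigOSmooth k 0 (fun y : E3 ↦ (ϱ ‖y‖ ^ 2 * ‖y‖ ^ 2 + a ^ 2 * y 2 ^ 2) / ‖y‖ ^ 4) := by
    have h := hS.mul hn4
    rw [show ((4 : ℝ) + -(4 : ℕ)) = 0 by norm_num] at h
    exact h.congr fun y ↦ by rw [div_eq_mul_inv, inv_pow]
  have hN : IsBigOSmooth k 4 fun y : E3 ↦ ϱ ‖y‖ ^ 2 * ‖y‖ ^ 2 + 2 * M * ϱ ‖y‖ * ‖y‖ ^ 2 + a ^ 2 * y 2 ^ 2 := by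
    have ha := (hρ.mul hρ).mul hn2
    have hb := (hρ.mul hn2).const_mul (2 * M)
    have hc := ((hy 2).mul (hy 2)).const_mul (a ^ 2)
    rw [show (1 : ℝ) + 1 + 2 = 4 by norm_num] at ha; rw [show (1 : ℝ) + 2 = 3 by norm_num] at hb
    rw [show (1 : ℝ) + 1 = 2 by norm_num] at hc
    exact ((ha.add (hb.mono (by norm_num))).add (hc.mono (by norm_num))).congr fun y ↦ by ring
  have h2 : IsBigOSmooth k (-4) (fun y : E3 ↦ a ^ 2 * (ϱ ‖y‖ ^ 2 * ‖y‖ ^ 2 + 2 * M * ϱ ‖y‖ * ‖y‖ ^ 2 +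
      a ^ 2 * y 2 ^ 2) / ((ϱ ‖y‖ ^ 2 * ‖y‖ ^ 2 + a ^ 2 * y 2 ^ 2) * ‖y‖ ^ 4)) := by
    have h := ((hN.mul hSi).mul hn4).const_mul (a ^ 2)
    rw [show ((4 : ℝ) + -4 + -(4 : ℕ)) = -4 by norm_num] at h
    exact h.congr fun y ↦ by rw [div_eq_mul_inv, mul_inv, inv_pow]; ring
  have hω : ∀ u : E3, IsBigOSmooth k 1 fun y : E3 ↦ y 0 * u 1 - y 1 * u 0 := fun u ↦
    (((hy 0).mul (isBigOSmooth_const k (u 1))).sub ((hy 1).mul (isBigOSmooth_const k (u 0)))).mono (by simp)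
  refine ⟨h1, h2, ?_⟩
  have h3 := h2.mul ((hω v).mul (hω w))
  rw [show (-4 : ℝ) + (1 + 1) = -2 by norm_num] at h3
  exact (h1.mul (isBigOSmooth_const k ⟪v, w⟫_ℝ) |>.mono (by norm_num)).add (h3.mono (by norm_num))


/-! ### The decay of `−(m/2) 𝓛_b h` -/

/-- **`−(m/2)(∂_b[h(v, w)] + h(Db v, w) + h(v, Db w)) ∈ O_k(s⁻³)`** for the far-zone lapse, shift and
closed-form induced metric of the cap (`D[h(v,w)] ∈ O_k(−1)` paired with `b ∈ O_k(−2)`; `Db ∈ O_k(−3)` paired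
with `h ∈ O_k(0)`; times `m ∈ O_k(0)`): the Dafermos–Rodnianski decay `k_{ij} = O(s⁻³)`, `∂k_{ij} = O(s⁻⁴)` of the
Boyer–Lindquist slice of Kerr in quasi-isotropic coordinates (Brandt–Seidel 1996, §II: `K_{rφ} = O(aM/r²)`,
`K_{θφ} = O(a³M/r³)`). [cite: BrandtSeidel1996, §II] [cite: Bartnik1986, Def. 2.1] -/
theorem isBigOSmooth_capFarK (k : ℕ) {b : E3 → E3} {m : E3 → ℝ}
    (hb : ∀ u : E3, b u = (-(2 * M * ϱ ‖u‖ * a * ‖u‖ ^ 2 /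
        ((ϱ ‖u‖ ^ 2 + a ^ 2) ^ 2 * ‖u‖ ^ 2 -
          (ϱ ‖u‖ ^ 2 - 2 * M * ϱ ‖u‖ + a ^ 2) * a ^ 2 * (‖u‖ ^ 2 - u 2 ^ 2)))) • !₂[-u 1, u 0, 0])
    (hm : ∀ u : E3, m u = Real.sqrt (((ϱ ‖u‖ ^ 2 + a ^ 2) ^ 2 * ‖u‖ ^ 2 -
          (ϱ ‖u‖ ^ 2 - 2 * M * ϱ ‖u‖ + a ^ 2) * a ^ 2 * (‖u‖ ^ 2 - u 2 ^ 2)) /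
        ((ϱ ‖u‖ ^ 2 * ‖u‖ ^ 2 + a ^ 2 * u 2 ^ 2) * (ϱ ‖u‖ ^ 2 - 2 * M * ϱ ‖u‖ + a ^ 2))))
    (v w : E3) :
    IsBigOSmooth k (-3) fun y : E3 ↦
      -(m y / 2 * (fderiv ℝ (fun z : E3 ↦
          (ϱ ‖z‖ ^ 2 * ‖z‖ ^ 2 + a ^ 2 * z 2 ^ 2) / ‖z‖ ^ 4 * ⟪v, w⟫_ℝ +
            a ^ 2 * (ϱ ‖z‖ ^ 2 * ‖z‖ ^ 2 + 2 * M * ϱ ‖z‖ * ‖z‖ ^ 2 + a ^ 2 * z 2 ^ 2) /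
              ((ϱ ‖z‖ ^ 2 * ‖z‖ ^ 2 + a ^ 2 * z 2 ^ 2) * ‖z‖ ^ 4) *
            ((z 0 * v 1 - z 1 * v 0) * (z 0 * w 1 - z 1 * w 0))) y (b y) +
        ((ϱ ‖y‖ ^ 2 * ‖y‖ ^ 2 + a ^ 2 * y 2 ^ 2) / ‖y‖ ^ 4 * ⟪fderiv ℝ b y v, w⟫_ℝ +
          a ^ 2 * (ϱ ‖y‖ ^ 2 * ‖y‖ ^ 2 + 2 * M * ϱ ‖y‖ * ‖y‖ ^ 2 + a ^ 2 * y 2 ^ 2) /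
              ((ϱ ‖y‖ ^ 2 * ‖y‖ ^ 2 + a ^ 2 * y 2 ^ 2) * ‖y‖ ^ 4) *
            ((y 0 * fderiv ℝ b y v 1 - y 1 * fderiv ℝ b y v 0) * (y 0 * w 1 - y 1 * w 0))) +
        ((ϱ ‖y‖ ^ 2 * ‖y‖ ^ 2 + a ^ 2 * y 2 ^ 2) / ‖y‖ ^ 4 * ⟪v, fderiv ℝ b y w⟫_ℝ +
          a ^ 2 * (ϱ ‖y‖ ^ 2 * ‖y‖ ^ 2 + 2 * M * ϱ ‖y‖ * ‖y‖ ^ 2 + a ^ 2 * y 2 ^ 2) /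
              ((ϱ ‖y‖ ^ 2 * ‖y‖ ^ 2 + a ^ 2 * y 2 ^ 2) * ‖y‖ ^ 4) *
            ((y 0 * v 1 - y 1 * v 0) * (y 0 * fderiv ℝ b y w 1 - y 1 * fderiv ℝ b y w 0))))) := by
  obtain ⟨hS4, hC, -⟩ := isBigOSmooth_far_hform hσ₅ hfar (M := M) (a := a) k v w
  obtain ⟨-, -, hh1⟩ := isBigOSmooth_far_hform hσ₅ hfar (M := M) (a := a) (k + 1) v w
  have hbk := isBigOSmooth_far_shift hσ₅ hfar k hb
  have hb1 := isBigOSmooth_far_shift hσ₅ hfar (k + 1) hb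
  have hmk := isBigOSmooth_far_invLapse hσ₅ hfar k hm
  have hy : ∀ i : Fin 3, IsBigOSmooth k 1 fun y : E3 ↦ y i := fun i ↦
    (isBigOSmooth_clm_apply (EuclideanSpace.proj i : E3 →L[ℝ] ℝ) k).congr fun y ↦ by simp
  have hω : ∀ u : E3, IsBigOSmooth k 1 fun y : E3 ↦ y 0 * u 1 - y 1 * u 0 := fun u ↦
    (((hy 0).mul (isBigOSmooth_const k (u 1))).sub ((hy 1).mul (isBigOSmooth_const k (u 0)))).mono (by simp)
  -- `∂_b[h(v, w)] ∈ O(−3)`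
  have T1 := hh1.fderiv.clm_apply hbk
  rw [show (0 : ℝ) - 1 + -2 = -3 by norm_num] at T1
  -- `Db ∈ O(−3)` and its pairings
  have hDb : ∀ u : E3, IsBigOSmooth k (-3) fun y : E3 ↦ fderiv ℝ b y u := fun u ↦ by
    have h := hb1.fderiv_apply_const u
    rwa [show (-2 : ℝ) - 1 = -3 by norm_num] at h
  have hDbi : ∀ (u : E3) (i : Fin 3), IsBigOSmooth k (-3) fun y : E3 ↦ fderiv ℝ b y u i := fun u i ↦
    ((hDb u).clm_comp_left (EuclideanSpace.proj i : E3 →L[ℝ] ℝ)).congr fun y ↦ by simp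
  have hiv : IsBigOSmooth k (-3) fun y : E3 ↦ ⟪fderiv ℝ b y v, w⟫_ℝ :=
    ((hDb v).clm_comp_left (innerSL ℝ w : E3 →L[ℝ] ℝ)).congr fun y ↦ by
      rw [innerSL_apply_apply, real_inner_comm]
  have hiw : IsBigOSmooth k (-3) fun y : E3 ↦ ⟪v, fderiv ℝ b y w⟫_ℝ :=
    ((hDb w).clm_comp_left (innerSL ℝ v : E3 →L[ℝ] ℝ)).congr fun y ↦ by rw [innerSL_apply_apply]
  have hωD : ∀ u : E3, IsBigOSmooth k (-2) fun y : E3 ↦ y 0 * fderiv ℝ b y u 1 - y 1 * fderiv ℝ b y u 0 :=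
    fun u ↦ by
    have h := ((hy 0).mul (hDbi u 1)).sub ((hy 1).mul (hDbi u 0))
    rwa [show (1 : ℝ) + -3 = -2 by norm_num] at h
  have T2 : IsBigOSmooth k (-3) fun y : E3 ↦
      (ϱ ‖y‖ ^ 2 * ‖y‖ ^ 2 + a ^ 2 * y 2 ^ 2) / ‖y‖ ^ 4 * ⟪fderiv ℝ b y v, w⟫_ℝ +
        a ^ 2 * (ϱ ‖y‖ ^ 2 * ‖y‖ ^ 2 + 2 * M * ϱ ‖y‖ * ‖y‖ ^ 2 + a ^ 2 * y 2 ^ 2) /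
            ((ϱ ‖y‖ ^ 2 * ‖y‖ ^ 2 + a ^ 2 * y 2 ^ 2) * ‖y‖ ^ 4) *
          ((y 0 * fderiv ℝ b y v 1 - y 1 * fderiv ℝ b y v 0) * (y 0 * w 1 - y 1 * w 0)) := by
    have h1 := hS4.mul hiv
    have h2 := hC.mul ((hωD v).mul (hω w))
    rw [show (0 : ℝ) + -3 = -3 by norm_num] at h1; rw [show (-4 : ℝ) + (-2 + 1) = -5 by norm_num] at h2
    exact h1.add (h2.mono (by norm_num))
  have T3 : IsBigOSmooth k (-3) fun y : E3 ↦
      (ϱ ‖y‖ ^ 2 * ‖y‖ ^ 2 + a ^ 2 * y 2 ^ 2) / ‖y‖ ^ 4 * ⟪v, fderiv ℝ b y w⟫_ℝ +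
        a ^ 2 * (ϱ ‖y‖ ^ 2 * ‖y‖ ^ 2 + 2 * M * ϱ ‖y‖ * ‖y‖ ^ 2 + a ^ 2 * y 2 ^ 2) /
            ((ϱ ‖y‖ ^ 2 * ‖y‖ ^ 2 + a ^ 2 * y 2 ^ 2) * ‖y‖ ^ 4) *
          ((y 0 * v 1 - y 1 * v 0) * (y 0 * fderiv ℝ b y w 1 - y 1 * fderiv ℝ b y w 0)) := by
    have h1 := hS4.mul hiw
    have h2 := hC.mul ((hω v).mul (hωD w))
    rw [show (0 : ℝ) + -3 = -3 by norm_num] at h1; rw [show (-4 : ℝ) + (1 + -2) = -5 by norm_num] at h2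
    exact h1.add (h2.mono (by norm_num))
  have h := (hmk.mul ((T1.add T2).add T3)).const_mul (-(1 / 2))
  rw [show (0 : ℝ) + -3 = -3 by norm_num] at h
  exact h.congr fun y ↦ by ring

end Symbols

end KerrCap

/-- **Registered export of this file** (sub-goal `cap_farSymbolK` of stub `stub_capFarK`): the far-zone shift field
of the cap is an `O_k(s⁻²)` symbol, `KerrCap.isBigOSmooth_far_shift`. [cite: BrandtSeidel1996, §II] -/
theorem cap_farSymbolK : ∀ {ϱ : ℝ → ℝ} {M a σ₅ : ℝ}, 0 < σ₅ → (∀ s, σ₅ ≤ s → ϱ s = s + M + (M ^ 2 - a ^ 2) / (4 * s)) → ∀ (k : ℕ) {b : E3 → E3}, (∀ u : E3, b u = (-(2 * M * ϱ ‖u‖ * a * ‖u‖ ^ 2 / ((ϱ ‖u‖ ^ 2 + a ^ 2) ^ 2 * ‖u‖ ^ 2 - (ϱ ‖u‖ ^ 2 - 2 * M * ϱ ‖u‖ + a ^ 2) * a ^ 2 * (‖u‖ ^ 2 - u 2 ^ 2)))) • !₂[-u 1, u 0, 0]) → IsBigOSmooth k (-2) b :=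
  fun hσ₅ hfar k _ hb ↦ KerrCap.isBigOSmooth_far_shift hσ₅ hfar k hb

end Summit.FinalStateConjecture.FinalStateConjecture.Theorems.SwallowTheDatum

end
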